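import Summits.QuantumFields.YangMills.Theorems.BalabanUVNodesPortS1Sect5Ward
import Literature.MathematicalPhysics.QuantumFieldTheory.Balaban1983to89.B12Ineq544Constant

/-!
# NODE O port, row PT-A-2 S5-κ — [Balaban1987RG1] (5.36)–(5.44) p. 297 and p. 264 «β_k(g) is defined on the interval [0, γ] … uniformly bounded» AT THE RE-CENTRED
# RECORD, FROM N09-SHAPE ROWS + (5.10): the β-readout of the record's (1.22) coefficient `betaOfRecord₁₃Ax` on the β-box — (5.37)–(5.38) with (5.44)-type bounds for
# `recordPlimAx`, `|β_{k+1}(v)| ≤ β′ = C·Σ_x |x|₁² e^{−δ₁|x|₁}`, and the flow letters `FlowStep.BetaUpperH β′ ½ β` ∕ `BetaLowerH (−β′) ½ β`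

CITATION HEADER.  [I] = [Balaban1987RG1]: (5.36)–(5.38) p. 297, (5.42)–(5.44) p. 297, p. 298 l. 5, p. 264 (the β-clause after (1.22)), (5.10) p. 293.  Porter PT-A-2 (`ymgap-nodeO-port-PTA-2`),
`--supports stmt-QuantumFields-27930 --as helper`.  REUSED BY NAME: `…Sect5Ward.taylorData3_recordPlimAx_of_rows` (the §5 bundle at the record from rows), `B12Ineq544Constant.norm_beta_le_betaPrime`
(‖β‖ ≤ β′ from (5.42) + (5.10)), `B12Rep537.rep538` ∕ `expBound_of_decay510` ((5.37)–(5.38) with (5.44)-type bounds), `B12Sec2to5.betaPrime510`, `FlowStep.BetaUpperH ∕ BetaLowerH`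
(= `B12Carve26Sect5BetaHyp.Hyp.{norm_beta_le, rep538, betaUpperH, betaLowerH_neg}` read at the record's carriers on the β-BOX; the `g_k = 0` face of print's coupling domain is
def-B's one-loop branch of `betaOfMerged`, K-lane, not read here).
DISPLAYED ROWS (asserted nowhere): the decay (5.10) of `recordPlimAx` (lens-1's line ∕ PT-H), `PolLimitExists`, `C²` at `0` of the chart, and the N09-shape rows of
`…Sect5PermOnAx.recordPlimAx_symmetries_of_rows` at the member read.
WHAT IS PROVED (0 sorry, 0 def): ★ `abs_betaOfRecord₁₃Ax_le_betaPrime_of_rows` (per member of the β-box), ★ `rep538_recordPlimAx_of_rows` ((5.37)–(5.38)+(5.44) at the record),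
★★ `betaUpperH_betaOfRecord₁₃Ax_of_rows` ∕ `betaLowerH_neg_betaOfRecord₁₃Ax_of_rows` (p. 264 «uniformly bounded» as the flow letters on the box `]0, ½]^{k+1}`, from rows on the
box + (5.10) on the box).  NOT the sign of β (unprinted; `Dag.Leaves.betaPositive`), NOT Theorem 2.
HONEST FRAMING.  Bookkeeping; nothing of Bałaban's estimates asserted, ported or discharged; 27930 signed-open (⁸-Ax-LR4), no claim held; finite 𝕋⁴ at fixed ε — NOT continuum∕OS∕Clay;
the Yang–Mills mass gap is NOT proved by any of this.
-/

noncomputable section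

open scoped Matrix.Norms.L2Operator Topology

namespace Summit.QuantumFields.YangMills.Theorems.BalabanUVNodesPortS1

open Filter MeasureTheory
open Literature.MathematicalPhysics.QuantumFieldTheory.Balaban1983to89
open Literature.MathematicalPhysics.QuantumFieldTheory.Balaban1983to89.Node00
open Literature.MathematicalPhysics.QuantumFieldTheory.GawedzkiKupiainen1985.PeriodicGleason (Pt ExpBound deltaIter K)
open T4Continuum (T4Family)
open Summit.QuantumFields.YangMills.Theorems.K0RecordFormatNames
open B12PolarizationTensor120 (expChart)
open B12Sec2to5 (Decay510 betaPrime510)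
open B12Rep537 (TaylorData3 ofReal rem538 wilsonQ MQ)
open FederbushMean (deltaFed)

variable (F : T4Family) (a₀ ε₂₉ : ℝ)

/-- **★ `|β_{k+1}(v)| ≤ β′` AT ONE MEMBER OF THE β-BOX, FROM ROWS + (5.10)** (p. 264 «uniformly bounded»; (5.42) + (5.10): `B12Ineq544Constant.norm_beta_le_betaPrime`): for `v ∈ Box ½ k`,
under the N09-shape rows at `(k, v)`, `PolLimitExists`, `C²` at `0` and the decay (5.10) of `recordPlimAx F a₀ ε₂₉ k v` with constants `C`, `δ₁ > 0`,
`|betaOfRecord₁₃Ax F 2 θ k v| ≤ betaPrime510 4 C δ₁ = C·Σ_x |x|₁² e^{−δ₁|x|₁}`. [cite: Balaban1987RG1, p.264 (β-clause), (5.42) p.297, (5.10) p.293] -/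
theorem abs_betaOfRecord₁₃Ax_le_betaPrime_of_rows (k : ℕ) (v : Fin (k + 1) → ℝ) (hv : v ∈ FlowStep.Box (1 / 2) k) {C δ₁ : ℝ} (hδ : 0 < δ₁)
    (h510 : ∀ μ ν : Fin 4, Decay510 (recordPlimAx F a₀ ε₂₉ k v μ ν) C δ₁)
    (hε₀ : 0 < (thetaFill F a₀ ε₂₉).ν.ε₀)
    (hlim : letI θ := thetaFill F a₀ ε₂₉
      letI := θ.instVβ₁; letI := θ.instVβ₂; letI := θ.instιβ
      PolLimitExists F (k + 1) (fun K => recordTermsAx F a₀ ε₂₉ k v K) θ.ρ8 θ.bV)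
    (hC2 : letI θ := thetaFill F a₀ ε₂₉
      letI := θ.instVβ₁; letI := θ.instVβ₂
      ∀ᶠ K in atTop, ContDiffAt ℝ 2 (expChart (recordTermsAx F a₀ ε₂₉ k v K) θ.ρ8) 0)
    (hrows : letI θ := thetaFill F a₀ ε₂₉
      ∀ᶠ K in atTop, k + 1 ≤ K ∧ ((((F.P K).d * (F.P K).L : ℕ) : ℝ)) ^ 2 / 4 * θ.ν.ε₀ < deltaFed (Fin 2) ∧
        (∀ j < k + 1, ∀ W ∈ domAltOfRecord F 2 θ.ν K (j + 1), UkExists F 2 K (j + 1) θ.ν.εreg W ∧ UniqueUkOrbit F 2 K (j + 1) θ.ν.εreg W) ∧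
        (∀ j < k + 1, ∀ W ∈ domAltOfRecord F 2 θ.ν K (j + 1), critCfgOfRecord F 2 θ.ν K j W ∈ domAltOfRecord F 2 θ.ν K j) ∧
        (∀ j < k + 1, domAltOfRecord F 2 θ.ν K (j + 1) ⊆
          regSetOfRecord F 2 K j (betaInputOfRecord F 2 (TβOfRecord₁₃ F 2) (chiβOfRecord₁₃Ax F 2 θ) K (T4FlagMemory.extd v) j)) ∧
        (∀ j < k + 1, ∀ᵐ U ∂(fieldMeasure (F.P K) j (SU 2)), (avOfRecord F 2 K j).avg U ∈ domAltOfRecord F 2 θ.ν K (j + 1) →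
          U ∉ domAltOfRecord F 2 θ.ν K j → chiβOfRecord₁₃Ax F 2 θ K (T4FlagMemory.extd v) j U = 0) ∧
        (∀ j < k + 1, Integrable (betaInputOfRecord F 2 (TβOfRecord₁₃ F 2) (chiβOfRecord₁₃Ax F 2 θ) K (T4FlagMemory.extd v) j) (fieldMeasure (F.P K) j (SU 2))) ∧
        (∀ W ∈ domAltOfRecord F 2 θ.ν K (k + 1),
          Averaging.iter (avOfRecord F 2 K) k (Uk F 2 K (k + 1) θ.εbg W) ∈ domAltOfRecord F 2 θ.ν K k ∧
            UkExists F 2 K (k + 1) θ.εbg W ∧ UniqueUkOrbit F 2 K (k + 1) θ.εbg W)) :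
    |betaOfRecord₁₃Ax F 2 (thetaFill F a₀ ε₂₉) k v| ≤ betaPrime510 4 C δ₁ := by
  have hT := taylorData3_recordPlimAx_of_rows F a₀ ε₂₉ (fun _ : Unit => k) (fun _ => v) hδ (fun _ => h510) hε₀ (fun _ => hlim) (fun _ => hC2)
    (fun _ => hrows) () hv 0 1
  have h := B12Ineq544Constant.norm_beta_le_betaPrime hδ (h510 0 1) hT (show (0 : Fin 4) ≠ 1 by decide)
  rwa [Complex.norm_real, Real.norm_eq_abs] at h

/-- **★ (5.37)–(5.38) WITH (5.44)-TYPE BOUNDS AT THE RECORD, FROM ROWS + (5.10)** (`B12Rep537.rep538`): on the β-box member `(k, v)`,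
`Π_{μν}(x) − β_{k+1}(v)·Q_{μν}(x) = Σ_{κλρ} (Δ*_κΔ*_λΔ*_ρ Π′_{κλρ})(x)` with every remainder coefficient kernel exponentially bounded at the full rate `δ₁` and the explicit constant
`K(δ₁,4)³·(C + |β|·MQ(δ₁,4))`. [cite: Balaban1987RG1, (5.37)-(5.38) p.297, (5.44) p.297, (5.10) p.293] -/
theorem rep538_recordPlimAx_of_rows (k : ℕ) (v : Fin (k + 1) → ℝ) (hv : v ∈ FlowStep.Box (1 / 2) k) {C δ₁ : ℝ} (hδ : 0 < δ₁)
    (h510 : ∀ μ ν : Fin 4, Decay510 (recordPlimAx F a₀ ε₂₉ k v μ ν) C δ₁)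
    (hε₀ : 0 < (thetaFill F a₀ ε₂₉).ν.ε₀)
    (hlim : letI θ := thetaFill F a₀ ε₂₉
      letI := θ.instVβ₁; letI := θ.instVβ₂; letI := θ.instιβ
      PolLimitExists F (k + 1) (fun K => recordTermsAx F a₀ ε₂₉ k v K) θ.ρ8 θ.bV)
    (hC2 : letI θ := thetaFill F a₀ ε₂₉
      letI := θ.instVβ₁; letI := θ.instVβ₂
      ∀ᶠ K in atTop, ContDiffAt ℝ 2 (expChart (recordTermsAx F a₀ ε₂₉ k v K) θ.ρ8) 0)
    (hrows : letI θ := thetaFill F a₀ ε₂₉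
      ∀ᶠ K in atTop, k + 1 ≤ K ∧ ((((F.P K).d * (F.P K).L : ℕ) : ℝ)) ^ 2 / 4 * θ.ν.ε₀ < deltaFed (Fin 2) ∧
        (∀ j < k + 1, ∀ W ∈ domAltOfRecord F 2 θ.ν K (j + 1), UkExists F 2 K (j + 1) θ.ν.εreg W ∧ UniqueUkOrbit F 2 K (j + 1) θ.ν.εreg W) ∧
        (∀ j < k + 1, ∀ W ∈ domAltOfRecord F 2 θ.ν K (j + 1), critCfgOfRecord F 2 θ.ν K j W ∈ domAltOfRecord F 2 θ.ν K j) ∧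
        (∀ j < k + 1, domAltOfRecord F 2 θ.ν K (j + 1) ⊆
          regSetOfRecord F 2 K j (betaInputOfRecord F 2 (TβOfRecord₁₃ F 2) (chiβOfRecord₁₃Ax F 2 θ) K (T4FlagMemory.extd v) j)) ∧
        (∀ j < k + 1, ∀ᵐ U ∂(fieldMeasure (F.P K) j (SU 2)), (avOfRecord F 2 K j).avg U ∈ domAltOfRecord F 2 θ.ν K (j + 1) →
          U ∉ domAltOfRecord F 2 θ.ν K j → chiβOfRecord₁₃Ax F 2 θ K (T4FlagMemory.extd v) j U = 0) ∧
        (∀ j < k + 1, Integrable (betaInputOfRecord F 2 (TβOfRecord₁₃ F 2) (chiβOfRecord₁₃Ax F 2 θ) K (T4FlagMemory.extd v) j) (fieldMeasure (F.P K) j (SU 2))) ∧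
        (∀ W ∈ domAltOfRecord F 2 θ.ν K (k + 1),
          Averaging.iter (avOfRecord F 2 K) k (Uk F 2 K (k + 1) θ.εbg W) ∈ domAltOfRecord F 2 θ.ν K k ∧
            UkExists F 2 K (k + 1) θ.εbg W ∧ UniqueUkOrbit F 2 K (k + 1) θ.εbg W))
    (μ ν : Fin 4) :
    (∀ x : Pt 4, ofReal (recordPlimAx F a₀ ε₂₉ k v μ ν) x - ((betaOfRecord₁₃Ax F 2 (thetaFill F a₀ ε₂₉) k v : ℝ) : ℂ) * wilsonQ μ ν x =
        ∑ μs : Fin 3 → Fin 4, deltaIter 3 μs (rem538 (ofReal (recordPlimAx F a₀ ε₂₉ k v μ ν)) ((betaOfRecord₁₃Ax F 2 (thetaFill F a₀ ε₂₉) k v : ℝ) : ℂ) μ ν μs) x) ∧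
      ∀ μs : Fin 3 → Fin 4, ExpBound δ₁ (K δ₁ 4 ^ 3 * (C + ‖((betaOfRecord₁₃Ax F 2 (thetaFill F a₀ ε₂₉) k v : ℝ) : ℂ)‖ * MQ δ₁ 4))
        (rem538 (ofReal (recordPlimAx F a₀ ε₂₉ k v μ ν)) ((betaOfRecord₁₃Ax F 2 (thetaFill F a₀ ε₂₉) k v : ℝ) : ℂ) μ ν μs) :=
  B12Rep537.rep538 hδ (B12Rep537.expBound_of_decay510 (h510 μ ν))
    (taylorData3_recordPlimAx_of_rows F a₀ ε₂₉ (fun _ : Unit => k) (fun _ => v) hδ (fun _ => h510) hε₀ (fun _ => hlim) (fun _ => hC2) (fun _ => hrows) () hv μ ν)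

/-- **★★ p. 264 «β_k(g) … UNIFORMLY BOUNDED» AS THE FLOW LETTER `FlowStep.BetaUpperH β′ ½ β` AT THE RE-CENTRED RECORD, FROM ROWS ON THE β-BOX + (5.10) ON THE β-BOX**:
if at EVERY member `(k, v)`, `v ∈ Box ½ k`, the N09-shape rows, `PolLimitExists`, `C²` at `0` and the decay (5.10) with ONE pair of constants `(C, δ₁)` hold, then
`β_{k+1}(v) ≤ β′ = betaPrime510 4 C δ₁` on every box — the ONE property of β that pp. 297–298 with (5.10) deliver (`B12Carve26Sect5BetaHyp` census: NOT the sign).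
[cite: Balaban1987RG1, p.264 (β-clause after (1.22)), (5.42) p.297, (5.10) p.293, p.298] -/
theorem betaUpperH_betaOfRecord₁₃Ax_of_rows {C δ₁ : ℝ} (hδ : 0 < δ₁)
    (h510 : ∀ (k : ℕ) (v : Fin (k + 1) → ℝ), v ∈ FlowStep.Box (1 / 2) k → ∀ μ ν : Fin 4, Decay510 (recordPlimAx F a₀ ε₂₉ k v μ ν) C δ₁)
    (hε₀ : 0 < (thetaFill F a₀ ε₂₉).ν.ε₀)
    (hlim : letI θ := thetaFill F a₀ ε₂₉
      letI := θ.instVβ₁; letI := θ.instVβ₂; letI := θ.instιβ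
      ∀ (k : ℕ) (v : Fin (k + 1) → ℝ), v ∈ FlowStep.Box (1 / 2) k → PolLimitExists F (k + 1) (fun K => recordTermsAx F a₀ ε₂₉ k v K) θ.ρ8 θ.bV)
    (hC2 : letI θ := thetaFill F a₀ ε₂₉
      letI := θ.instVβ₁; letI := θ.instVβ₂
      ∀ (k : ℕ) (v : Fin (k + 1) → ℝ), v ∈ FlowStep.Box (1 / 2) k → ∀ᶠ K in atTop, ContDiffAt ℝ 2 (expChart (recordTermsAx F a₀ ε₂₉ k v K) θ.ρ8) 0)
    (hrows : letI θ := thetaFill F a₀ ε₂₉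
      ∀ (k : ℕ) (v : Fin (k + 1) → ℝ), v ∈ FlowStep.Box (1 / 2) k → ∀ᶠ K in atTop, k + 1 ≤ K ∧ ((((F.P K).d * (F.P K).L : ℕ) : ℝ)) ^ 2 / 4 * θ.ν.ε₀ < deltaFed (Fin 2) ∧
        (∀ j < k + 1, ∀ W ∈ domAltOfRecord F 2 θ.ν K (j + 1), UkExists F 2 K (j + 1) θ.ν.εreg W ∧ UniqueUkOrbit F 2 K (j + 1) θ.ν.εreg W) ∧
        (∀ j < k + 1, ∀ W ∈ domAltOfRecord F 2 θ.ν K (j + 1), critCfgOfRecord F 2 θ.ν K j W ∈ domAltOfRecord F 2 θ.ν K j) ∧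
        (∀ j < k + 1, domAltOfRecord F 2 θ.ν K (j + 1) ⊆
          regSetOfRecord F 2 K j (betaInputOfRecord F 2 (TβOfRecord₁₃ F 2) (chiβOfRecord₁₃Ax F 2 θ) K (T4FlagMemory.extd v) j)) ∧
        (∀ j < k + 1, ∀ᵐ U ∂(fieldMeasure (F.P K) j (SU 2)), (avOfRecord F 2 K j).avg U ∈ domAltOfRecord F 2 θ.ν K (j + 1) →
          U ∉ domAltOfRecord F 2 θ.ν K j → chiβOfRecord₁₃Ax F 2 θ K (T4FlagMemory.extd v) j U = 0) ∧
        (∀ j < k + 1, Integrable (betaInputOfRecord F 2 (TβOfRecord₁₃ F 2) (chiβOfRecord₁₃Ax F 2 θ) K (T4FlagMemory.extd v) j) (fieldMeasure (F.P K) j (SU 2))) ∧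
        (∀ W ∈ domAltOfRecord F 2 θ.ν K (k + 1),
          Averaging.iter (avOfRecord F 2 K) k (Uk F 2 K (k + 1) θ.εbg W) ∈ domAltOfRecord F 2 θ.ν K k ∧
            UkExists F 2 K (k + 1) θ.εbg W ∧ UniqueUkOrbit F 2 K (k + 1) θ.εbg W)) :
    FlowStep.BetaUpperH (betaPrime510 4 C δ₁) (1 / 2) (betaOfRecord₁₃Ax F 2 (thetaFill F a₀ ε₂₉)) := fun k v hv =>
  (le_abs_self _).trans (abs_betaOfRecord₁₃Ax_le_betaPrime_of_rows F a₀ ε₂₉ k v hv hδ (h510 k v hv) hε₀ (hlim k v hv) (hC2 k v hv) (hrows k v hv))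

/-- The two-sided companion `FlowStep.BetaLowerH (−β′) ½ β` (|β| ≤ β′ read downward; NOT the sign `BetaLowerH 0`, which print does not deliver). [cite: Balaban1987RG1, p.264 (β-clause), (5.42) p.297, (5.10) p.293] -/
theorem betaLowerH_neg_betaOfRecord₁₃Ax_of_rows {C δ₁ : ℝ} (hδ : 0 < δ₁)
    (h510 : ∀ (k : ℕ) (v : Fin (k + 1) → ℝ), v ∈ FlowStep.Box (1 / 2) k → ∀ μ ν : Fin 4, Decay510 (recordPlimAx F a₀ ε₂₉ k v μ ν) C δ₁)
    (hε₀ : 0 < (thetaFill F a₀ ε₂₉).ν.ε₀)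
    (hlim : letI θ := thetaFill F a₀ ε₂₉
      letI := θ.instVβ₁; letI := θ.instVβ₂; letI := θ.instιβ
      ∀ (k : ℕ) (v : Fin (k + 1) → ℝ), v ∈ FlowStep.Box (1 / 2) k → PolLimitExists F (k + 1) (fun K => recordTermsAx F a₀ ε₂₉ k v K) θ.ρ8 θ.bV)
    (hC2 : letI θ := thetaFill F a₀ ε₂₉
      letI := θ.instVβ₁; letI := θ.instVβ₂
      ∀ (k : ℕ) (v : Fin (k + 1) → ℝ), v ∈ FlowStep.Box (1 / 2) k → ∀ᶠ K in atTop, ContDiffAt ℝ 2 (expChart (recordTermsAx F a₀ ε₂₉ k v K) θ.ρ8) 0)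
    (hrows : letI θ := thetaFill F a₀ ε₂₉
      ∀ (k : ℕ) (v : Fin (k + 1) → ℝ), v ∈ FlowStep.Box (1 / 2) k → ∀ᶠ K in atTop, k + 1 ≤ K ∧ ((((F.P K).d * (F.P K).L : ℕ) : ℝ)) ^ 2 / 4 * θ.ν.ε₀ < deltaFed (Fin 2) ∧
        (∀ j < k + 1, ∀ W ∈ domAltOfRecord F 2 θ.ν K (j + 1), UkExists F 2 K (j + 1) θ.ν.εreg W ∧ UniqueUkOrbit F 2 K (j + 1) θ.ν.εreg W) ∧
        (∀ j < k + 1, ∀ W ∈ domAltOfRecord F 2 θ.ν K (j + 1), critCfgOfRecord F 2 θ.ν K j W ∈ domAltOfRecord F 2 θ.ν K j) ∧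
        (∀ j < k + 1, domAltOfRecord F 2 θ.ν K (j + 1) ⊆
          regSetOfRecord F 2 K j (betaInputOfRecord F 2 (TβOfRecord₁₃ F 2) (chiβOfRecord₁₃Ax F 2 θ) K (T4FlagMemory.extd v) j)) ∧
        (∀ j < k + 1, ∀ᵐ U ∂(fieldMeasure (F.P K) j (SU 2)), (avOfRecord F 2 K j).avg U ∈ domAltOfRecord F 2 θ.ν K (j + 1) →
          U ∉ domAltOfRecord F 2 θ.ν K j → chiβOfRecord₁₃Ax F 2 θ K (T4FlagMemory.extd v) j U = 0) ∧
        (∀ j < k + 1, Integrable (betaInputOfRecord F 2 (TβOfRecord₁₃ F 2) (chiβOfRecord₁₃Ax F 2 θ) K (T4FlagMemory.extd v) j) (fieldMeasure (F.P K) j (SU 2))) ∧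
        (∀ W ∈ domAltOfRecord F 2 θ.ν K (k + 1),
          Averaging.iter (avOfRecord F 2 K) k (Uk F 2 K (k + 1) θ.εbg W) ∈ domAltOfRecord F 2 θ.ν K k ∧
            UkExists F 2 K (k + 1) θ.εbg W ∧ UniqueUkOrbit F 2 K (k + 1) θ.εbg W)) :
    FlowStep.BetaLowerH (-betaPrime510 4 C δ₁) (1 / 2) (betaOfRecord₁₃Ax F 2 (thetaFill F a₀ ε₂₉)) := fun k v hv =>
  (neg_le_neg (abs_betaOfRecord₁₃Ax_le_betaPrime_of_rows F a₀ ε₂₉ k v hv hδ (h510 k v hv) hε₀ (hlim k v hv) (hC2 k v hv) (hrows k v hv))).trans (neg_abs_le _)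

end Summit.QuantumFields.YangMills.Theorems.BalabanUVNodesPortS1

end
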